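/-
Copyright (c) 2026 the pub-hodgecm-mathlib formalisation cell (harness21).  Prover seat hodgecm-mathlib-LH4-p13 (g2), req620 Track A «(D-RAM) FOUR-FRAME» squad
(heir LEAD F0P3a-plan lineage; dealer LH4-plan lineage; MS ROAD A, Stage B: the RE-KEYED type-2 on-branch sockets — `polarisationCount = 1` on the three `T`-strata and the
`n₂·w` sockets of the B10₂ assembly; LH4-p11 (g2) RULING 2026-09-04T00:53Z (dealer WORD #21) on LH4-p09 (g2)'s flag).  2026-09-04.
-/
import Summits.HodgeConjecture.HodgeConjecture.Theorems.F0P3cDyRamDiagonalSplitCountTwoUnique          -- ★ B9-0₂ UNIQ (axis 3) p856308 (this seat): `typeTwoPolarisation_unique_of_hasAxis_T3`; brings ★ B4₂ FILE 2, ★ StrataDefs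
import Summits.HodgeConjecture.HodgeConjecture.Theorems.F0P3cDyRamDiagonalSplitCountTwoUniqueAxisOne   -- ★ B9-0₂ UNIQ (axis 1) p856309 (this seat)
import Summits.HodgeConjecture.HodgeConjecture.Theorems.F0P3cDyRamDiagonalSplitCountTwoUniqueAxisTwo   -- ★ B9-0₂ UNIQ (axis 2) p856310 (this seat)
import Summits.HodgeConjecture.HodgeConjecture.Theorems.F0P3cDyRamDiagonalSplitCountTwoSockets         -- ★ B4₂ FILE 5 p856307 (this seat): `finsum_stabiliserWeight_stratumTwo_T3 ∕ _T1 ∕ _T2`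
import Summits.HodgeConjecture.HodgeConjecture.Theorems.F0P3cDyRamDiagonalPolarisationCountTools     -- TOOLS (this seat): `polarisationCount_eq_one_of_forall_unique`, `finsum_mem_mul_eq_of_forall_eq_one`; brings ★ StrataDefs ED. 3
import HarnessLib

/-!
# Crux `H413`, MS ROAD A, STAGE B — THE RE-KEYED ON-BRANCH SOCKETS: `n₂ = 1` ON THE `T`-STRATA AND `Σ n₂·w` THERE

Cell `hodgecm-mathlib` (D-0151), FLOOR 0, crux item H413 = `stmt-HodgeConjecture-24833`, route of record `HCCMUnconditional`; squad F0∕P3c∕LH4 (req618∕req620).  THEOREMS ONLY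
(no `def`, no instance, no notation, no `sorry`, default heartbeats); lane `--supports stmt-HodgeConjecture-24833 --as helper` (count-neutral).  Road target: tree
`Cruxes/H413/Lines/F0_P3c_DyRamFourFrame_U3_Laws.lean` stub `stub_U3_stableModelSum` (MS), type-2 half.  After LH4-p09 (g2)'s flag (2026-09-04T00:42:58Z: on the glued
type-2 strata with `ρ` even the polarisations form `q` cosets of `S_F`, not one) the type-2 Stage B heads were RE-KEYED (LH4-p11 (g2) ruling 00:53:03Z, ★ StrataDefs ED. 3
`polarisationCount σ ϖ tv M = #(Δ_tv(M) ∕ S_F(M))`): every socket now reads `∑ᶠ_{M ∈ stratumTwo σ ϖ T a} (polarisationCount σ ϖ 2 M : ℚ) · stabiliserWeight σ M = ‹table›`.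
On the three ON-BRANCH strata the count is ONE (the ruling, (4): «T: count = 1 ⇒ same values»), and THIS FILE proves it and delivers the re-keyed sockets.

WHAT IS PROVED (the datum letters of ★ B1 in §2; the generic one-coset ⇒ `n = 1` step is `F0P3cDyRamDiagonalPolarisationCountTools`, this seat).
* §1 `polarisationCount_two_eq_one_of_hasAxis_T3 ∕ _T1 ∕ _T2` — `n₂(M) = 1` for every type-2-polarisable `M ∈ 𝓛₀(T)` of axis vector `(s,s,0) ∕ (0,s,s) ∕ (s,0,s)`, `s ≥ 1`
  (existence = the hypothesis; uniqueness = B9-0₂ UNIQ `typeTwoPolarisation_unique_of_hasAxis_T3∕T1∕T2`, this seat); `…_of_mem_stratumTwo_T3 ∕ _T1 ∕ _T2`.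
* §2 HEADS **`finsum_polarisationCount_mul_stabiliserWeight_stratumTwo_T3 ∕ _T1 ∕ _T2 (hD) (hE) (hT) (s) (hs : 1 ≤ s) :
  ∑ᶠ M ∈ stratumTwo σ ϖ T (s,s,0)∕(0,s,s)∕(s,0,s), (polarisationCount σ ϖ 2 M : ℚ) * stabiliserWeight σ M = if ¬ 2 ∣ s ∧ s ≤ n₃∕n₁∕n₂ then q^(s∕2) else 0`** — the B10₂ skeleton
  `B10-StableCountTypeTwo.SKELETON.v1` 08e5e6e2 sockets `stub_P_T3 ∕ stub_B4_T1 ∕ stub_P_T2` RE-KEYED per the ruling (4), from ★ B4₂ FILE 5 by §1.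
HONEST LABEL.  Count-neutral (`--supports`); nothing printed is asserted; (MS) and the census laws stay PROVER TARGETS until the Stage B bricks and B10∕B10₂ land; `HC_CM` is proved only
modulo the 7 printed citations (2 remaining named inputs: hLiu418 = `stmt-HodgeConjecture-24832`, h413 = `stmt-HodgeConjecture-24833`) until rung 0 closes.

## References
* [Kottwitz1986BaseChangeUnits] R. E. Kottwitz, *Base change for unit elements of Hecke algebras*, Compositio Math. 60 (1986), §1 pp. 240–241.
* [Rogawski1990] J. D. Rogawski, *Automorphic Representations of Unitary Groups in Three Variables*, Ann. of Math. Stud. 123 (1990), §4.9 Prop. 4.9.1 (a) p. 55.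
-/

set_option autoImplicit false

noncomputable section

namespace Summit.HodgeConjecture.HodgeConjecture.Cruxes.H413.F0P3cDyRamDiagonalSplitCountTwoMult

open Matrix
open Literature.NumberTheory.Automorphic Literature.NumberTheory.Automorphic.HermitianLattice
open Literature.NumberTheory.Automorphic.UnitaryLatticeTree Literature.NumberTheory.Automorphic.UnitaryThreeFourFrame
open Summit.HodgeConjecture.HodgeConjecture.Cruxes.H413.F0P3cDyRamDiagonalTorusDefs
open Summit.HodgeConjecture.HodgeConjecture.Cruxes.H413.F0P3cDyRamDiagonalStrataDefs
open Summit.HodgeConjecture.HodgeConjecture.Cruxes.H413.F0P3cDyRamDiagonalSplitCountTwoUnique (typeTwoPolarisation_unique_of_hasAxis_T3)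
open Summit.HodgeConjecture.HodgeConjecture.Cruxes.H413.F0P3cDyRamDiagonalSplitCountTwoUniqueAxisOne (typeTwoPolarisation_unique_of_hasAxis_T1)
open Summit.HodgeConjecture.HodgeConjecture.Cruxes.H413.F0P3cDyRamDiagonalSplitCountTwoUniqueAxisTwo (typeTwoPolarisation_unique_of_hasAxis_T2)
open Summit.HodgeConjecture.HodgeConjecture.Cruxes.H413.F0P3cDyRamDiagonalSplitCountTwoSockets
open Summit.HodgeConjecture.HodgeConjecture.Cruxes.H413.F0P3cDyRamDiagonalPolarisationCountTools
open scoped Valued WithZero Matrix MatrixGroups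

/-! ## §1  `n₂ = 1` on the three on-branch strata -/

section Strata

variable {K : Type*} [Field K] [Valued K ℤᵐ⁰]


/-- **`n₂(M) = 1` FOR A TYPE-2-POLARISABLE `M ∈ 𝓛₀(T)` OF AXIS VECTOR `(s,s,0)`** (`s ≥ 1`): existence is the hypothesis, uniqueness is B9-0₂ UNIQ on the axis-3 stratum.
[cite: Kottwitz1986BaseChangeUnits, §1 pp. 240–241] [cite: Rogawski1990, §4.9 Prop. 4.9.1 (a) p. 55] -/
theorem polarisationCount_two_eq_one_of_hasAxis_T3 {σ : K →+* K} (hvσ : ∀ a, Valued.v (σ a) = Valued.v a)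
    (hfix : ∀ x : K, σ x = x → x ≠ 0 → ∃ n : ℤ, Valued.v x = WithZero.exp (2 * n)) {ϖ : K} (hϖ : Valued.v ϖ = WithZero.exp (-1 : ℤ))
    {T : GL (Fin 3) K} {M : Submodule 𝒪[K] (Fin 3 → K)} (hM : M ∈ normalisedStableLattices T) {s : ℕ} (hs : 1 ≤ s) (ha : HasAxis ϖ M ![s, s, 0])
    (hpol : IsTypeTwoPolarisable σ ϖ M) : polarisationCount σ ϖ 2 M = 1 :=
  polarisationCount_eq_one_of_forall_unique hpol (typeTwoPolarisation_unique_of_hasAxis_T3 hvσ hfix hϖ hM hs ha)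

/-- **`n₂(M) = 1`, AXIS VECTOR `(0,s,s)`.** [cite: Kottwitz1986BaseChangeUnits, §1 pp. 240–241] [cite: Rogawski1990, §4.9 Prop. 4.9.1 (a) p. 55] -/
theorem polarisationCount_two_eq_one_of_hasAxis_T1 {σ : K →+* K} (hvσ : ∀ a, Valued.v (σ a) = Valued.v a)
    (hfix : ∀ x : K, σ x = x → x ≠ 0 → ∃ n : ℤ, Valued.v x = WithZero.exp (2 * n)) {ϖ : K} (hϖ : Valued.v ϖ = WithZero.exp (-1 : ℤ))
    {T : GL (Fin 3) K} {M : Submodule 𝒪[K] (Fin 3 → K)} (hM : M ∈ normalisedStableLattices T) {s : ℕ} (hs : 1 ≤ s) (ha : HasAxis ϖ M ![0, s, s])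
    (hpol : IsTypeTwoPolarisable σ ϖ M) : polarisationCount σ ϖ 2 M = 1 :=
  polarisationCount_eq_one_of_forall_unique hpol (typeTwoPolarisation_unique_of_hasAxis_T1 hvσ hfix hϖ hM hs ha)

/-- **`n₂(M) = 1`, AXIS VECTOR `(s,0,s)`.** [cite: Kottwitz1986BaseChangeUnits, §1 pp. 240–241] [cite: Rogawski1990, §4.9 Prop. 4.9.1 (a) p. 55] -/
theorem polarisationCount_two_eq_one_of_hasAxis_T2 {σ : K →+* K} (hvσ : ∀ a, Valued.v (σ a) = Valued.v a)
    (hfix : ∀ x : K, σ x = x → x ≠ 0 → ∃ n : ℤ, Valued.v x = WithZero.exp (2 * n)) {ϖ : K} (hϖ : Valued.v ϖ = WithZero.exp (-1 : ℤ))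
    {T : GL (Fin 3) K} {M : Submodule 𝒪[K] (Fin 3 → K)} (hM : M ∈ normalisedStableLattices T) {s : ℕ} (hs : 1 ≤ s) (ha : HasAxis ϖ M ![s, 0, s])
    (hpol : IsTypeTwoPolarisable σ ϖ M) : polarisationCount σ ϖ 2 M = 1 :=
  polarisationCount_eq_one_of_forall_unique hpol (typeTwoPolarisation_unique_of_hasAxis_T2 hvσ hfix hϖ hM hs ha)

/-- **`n₂ ≡ 1` ON `stratumTwo σ ϖ T (s,s,0)`.** [cite: Kottwitz1986BaseChangeUnits, §1 pp. 240–241] -/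
theorem polarisationCount_two_eq_one_of_mem_stratumTwo_T3 {σ : K →+* K} (hvσ : ∀ a, Valued.v (σ a) = Valued.v a)
    (hfix : ∀ x : K, σ x = x → x ≠ 0 → ∃ n : ℤ, Valued.v x = WithZero.exp (2 * n)) {ϖ : K} (hϖ : Valued.v ϖ = WithZero.exp (-1 : ℤ))
    {T : GL (Fin 3) K} {s : ℕ} (hs : 1 ≤ s) {M : Submodule 𝒪[K] (Fin 3 → K)} (hM : M ∈ stratumTwo σ ϖ T ![s, s, 0]) : polarisationCount σ ϖ 2 M = 1 :=
  polarisationCount_two_eq_one_of_hasAxis_T3 hvσ hfix hϖ hM.1 hs hM.2.2 hM.2.1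

/-- **`n₂ ≡ 1` ON `stratumTwo σ ϖ T (0,s,s)`.** [cite: Kottwitz1986BaseChangeUnits, §1 pp. 240–241] -/
theorem polarisationCount_two_eq_one_of_mem_stratumTwo_T1 {σ : K →+* K} (hvσ : ∀ a, Valued.v (σ a) = Valued.v a)
    (hfix : ∀ x : K, σ x = x → x ≠ 0 → ∃ n : ℤ, Valued.v x = WithZero.exp (2 * n)) {ϖ : K} (hϖ : Valued.v ϖ = WithZero.exp (-1 : ℤ))
    {T : GL (Fin 3) K} {s : ℕ} (hs : 1 ≤ s) {M : Submodule 𝒪[K] (Fin 3 → K)} (hM : M ∈ stratumTwo σ ϖ T ![0, s, s]) : polarisationCount σ ϖ 2 M = 1 :=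
  polarisationCount_two_eq_one_of_hasAxis_T1 hvσ hfix hϖ hM.1 hs hM.2.2 hM.2.1

/-- **`n₂ ≡ 1` ON `stratumTwo σ ϖ T (s,0,s)`.** [cite: Kottwitz1986BaseChangeUnits, §1 pp. 240–241] -/
theorem polarisationCount_two_eq_one_of_mem_stratumTwo_T2 {σ : K →+* K} (hvσ : ∀ a, Valued.v (σ a) = Valued.v a)
    (hfix : ∀ x : K, σ x = x → x ≠ 0 → ∃ n : ℤ, Valued.v x = WithZero.exp (2 * n)) {ϖ : K} (hϖ : Valued.v ϖ = WithZero.exp (-1 : ℤ))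
    {T : GL (Fin 3) K} {s : ℕ} (hs : 1 ≤ s) {M : Submodule 𝒪[K] (Fin 3 → K)} (hM : M ∈ stratumTwo σ ϖ T ![s, 0, s]) : polarisationCount σ ϖ 2 M = 1 :=
  polarisationCount_two_eq_one_of_hasAxis_T2 hvσ hfix hϖ hM.1 hs hM.2.2 hM.2.1

end Strata

/-! ## §2  The re-keyed B10₂ on-branch sockets `Σ n₂·w` -/

section Sockets

variable {K : Type} [Field K] [Valued K ℤᵐ⁰] [Fintype 𝓀[K]] {σ : K →+* K} {ϖ : K} {d t : ℕ} {α β : K} {N₀ n₁ n₂ n₃ : ℕ} {T : GL (Fin 3) K}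

/-- **RE-KEYED SOCKET `stub_P_T3` — `Σ_{M ∈ stratumTwo(T,(s,s,0))} n₂(M)·w(M) = q^{s∕2}` if `s` is odd and `s ≤ n₃`, else `0`** (`n₂ ≡ 1` there, §1; values ★ B4₂ FILE 5).
[cite: Kottwitz1986BaseChangeUnits, §1 pp. 240–241] [cite: Rogawski1990, §4.9 Prop. 4.9.1 (a) p. 55] -/
theorem finsum_polarisationCount_mul_stabiliserWeight_stratumTwo_T3 (hD : IsRamifiedQuadraticDatum σ ϖ d t) (hE : IsElementDatum σ ϖ N₀ α β n₁ n₂ n₃)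
    (hT : (T : Matrix (Fin 3) (Fin 3) K) = Matrix.diagonal ![α, β, 1]) (s : ℕ) (hs : 1 ≤ s) :
    ∑ᶠ M ∈ stratumTwo σ ϖ T ![s, s, 0], (polarisationCount σ ϖ 2 M : ℚ) * stabiliserWeight σ M =
      if ¬ 2 ∣ s ∧ s ≤ n₃ then ((Fintype.card 𝓀[K] : ℚ) ^ (s / 2)) else 0 := by
  rw [finsum_mem_mul_eq_of_forall_eq_one _ _ fun M hM => polarisationCount_two_eq_one_of_mem_stratumTwo_T3 hD.2.1 hD.2.2.2.1 hD.2.2.1 hs hM]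
  exact finsum_stabiliserWeight_stratumTwo_T3 hD hE hT s hs

/-- **RE-KEYED SOCKET `stub_B4_T1` — axis `(0,s,s)`, bound `n₁`.** [cite: Kottwitz1986BaseChangeUnits, §1 pp. 240–241] [cite: Rogawski1990, §4.9 Prop. 4.9.1 (a) p. 55] -/
theorem finsum_polarisationCount_mul_stabiliserWeight_stratumTwo_T1 (hD : IsRamifiedQuadraticDatum σ ϖ d t) (hE : IsElementDatum σ ϖ N₀ α β n₁ n₂ n₃)
    (hT : (T : Matrix (Fin 3) (Fin 3) K) = Matrix.diagonal ![α, β, 1]) (s : ℕ) (hs : 1 ≤ s) :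
    ∑ᶠ M ∈ stratumTwo σ ϖ T ![0, s, s], (polarisationCount σ ϖ 2 M : ℚ) * stabiliserWeight σ M =
      if ¬ 2 ∣ s ∧ s ≤ n₁ then ((Fintype.card 𝓀[K] : ℚ) ^ (s / 2)) else 0 := by
  rw [finsum_mem_mul_eq_of_forall_eq_one _ _ fun M hM => polarisationCount_two_eq_one_of_mem_stratumTwo_T1 hD.2.1 hD.2.2.2.1 hD.2.2.1 hs hM]
  exact finsum_stabiliserWeight_stratumTwo_T1 hD hE hT s hs

/-- **RE-KEYED SOCKET `stub_P_T2` — axis `(s,0,s)`, bound `n₂`.** [cite: Kottwitz1986BaseChangeUnits, §1 pp. 240–241] [cite: Rogawski1990, §4.9 Prop. 4.9.1 (a) p. 55] -/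
theorem finsum_polarisationCount_mul_stabiliserWeight_stratumTwo_T2 (hD : IsRamifiedQuadraticDatum σ ϖ d t) (hE : IsElementDatum σ ϖ N₀ α β n₁ n₂ n₃)
    (hT : (T : Matrix (Fin 3) (Fin 3) K) = Matrix.diagonal ![α, β, 1]) (s : ℕ) (hs : 1 ≤ s) :
    ∑ᶠ M ∈ stratumTwo σ ϖ T ![s, 0, s], (polarisationCount σ ϖ 2 M : ℚ) * stabiliserWeight σ M =
      if ¬ 2 ∣ s ∧ s ≤ n₂ then ((Fintype.card 𝓀[K] : ℚ) ^ (s / 2)) else 0 := by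
  rw [finsum_mem_mul_eq_of_forall_eq_one _ _ fun M hM => polarisationCount_two_eq_one_of_mem_stratumTwo_T2 hD.2.1 hD.2.2.2.1 hD.2.2.1 hs hM]
  exact finsum_stabiliserWeight_stratumTwo_T2 hD hE hT s hs

end Sockets

end Summit.HodgeConjecture.HodgeConjecture.Cruxes.H413.F0P3cDyRamDiagonalSplitCountTwoMult

end
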